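/-
Origin: expansion seat `planner-pub-hodgecm-qw8-g11-0`, handover #1 REPLACE (DOC-ONLY) md5 3e591a0d7601046c15b114dc408e13c9 (352 l.) SUPERSEDES tree `HodgeCM/StubTree/Qw8.lean` 8d0f9b7c (344 l.): docstrings added to every undocumented theorem/def (CONVENTIONS §3 debt → 0), comment-stripped code IDENTICAL to the tree copy (residue md5 88379268; no declaration, statement or proof changed); imports unchanged (HodgeCM.Geometry.WeightVectors; NO rewrite); check-wip  (`HOME/pub-hodgecm-qw8-g11/lean/Qw8g11/Qw8.lean`, md5 3e591a0d, 352 lines);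
landed by the packager successor (mc-unitary-1-g3, gen-8 kit) in gate run 32 REPLACES the earlier landed copy of `HodgeCM/StubTree/Qw8.lean` (verbatim).
-/
/-
Copyright: pub-hodgecm formalisation cell (harness21, 2026). New file (not vendored).
Origin: expansion seat `planner-pub-hodgecm-qw8-0` (unit pub-hodgecm-qw8), handover v1 2026-08-18T03:01:45Z
(`HOME/pub-hodgecm-qw8/Qw8.lean`, md5 66c2c6e6); landed by the gen-5 packager as `HodgeCM/StubTree/Qw8.lean`
(header normalised, trailing `#print axioms` lines moved to `HodgeCM/AxiomAudit.lean` / `scripts/headline-decls.txt`; body verbatim).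
-/
import Summits.HodgeConjecture.HodgeCM.Geometry.WeightVectors

/-!
# The proof obligations of `Qw8Sufficiency` ([QW8] Thm 2.5), typed

`HodgeCM.Universe.Qw8Sufficiency` (Geometry/WeightVectors.lean) is the monolithic hypothesis
"[QW8] Thm 2.5 (sufficiency) + the §3 ā-bridge + Milne 1999".  Its source is the INTERNAL, unrefereed
2001-programme preprint [QW8] = *Lefschetz characters of CM abelian varieties …* (free seat y3 of the
wall `hodge-w-quartic-weil-eightfold`), v1 = git blob `892bb948`
(`inputs/2001/literature__sources__internal-hodge-w-quartic-weil-eightfold-y3__paper-v1-892bb948.tex`,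
origin `literature/sources/internal-hodge-w-quartic-weil-eightfold-y3/paper-v1-892bb948.tex` at commit
`a463a4c8cc18`); "§2.5" is its **Theorem 2.5** (label `t:suff`, tex ll. 245–262), quoted verbatim with the
surrounding §2.2–§2.4 in `pub-hodgecm-qw8/QW8-SOURCE.md`.

The proof of Theorem 2.5 has five steps (i)–(v).  This file turns the monolithic hypothesis into a
conjunction of small named ones, each a `Prop` about the pool `WVec` of NONZERO complex weight vectors on
the products `A′ = ∏_j A_{(F,Θ_j)}` (zero is a weight vector of every weight and is trivially algebraic, so
it must be excluded for the relational steps to mean anything):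

* `Qw8Conj`        — step (i): complex conjugation of coefficients negates the Lefschetz character and
                      preserves algebraicity.  **Discharged** here (`qw8Conj_holds`, no model axiom).
* `Qw8ExtProd`     — step (ii): exterior products of algebraic weight vectors (Künneth); `a` is additive.
* `Qw8DualPushPull`— steps (iii)+(v): the Poincaré-dual partner `w^∨` (`a(w^∨) = −a(w)`) and the
                      push–pull `e = pr_*((e ⊠ w^∨) · pr^* w)`.
* `Qw8Milne`       — step (iv): a nonzero weight vector with vanishing Lefschetz character is a
                      (complexified) algebraic class — [QW8] Lemma 2.4(b) + eq. (3) = **Milne, Duke Math. J.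
                      96 (1999), Thm 3.2, Thm 4.4, Cor 4.5, Cor 4.7** (the one PRINT input).
* `Qw8FaceBridge`  — the "§3 ā-bridge" ([QW8] Lemma 2.9 + Remark 2.6(a); Prop. 3.4(a) for `(ℤ/2)³`): an
                      algebraic face line `W_F(P(f))` yields, for every `σ₀`, a nonzero ALGEBRAIC weight
                      vector of weight `(j ↦ {σ₀})` on `P(f)`, whose character is by definition
                      `lefChar f.corner (fun _ ↦ {σ₀})` (the combinatorial half of the bridge,
                      `lefChar_corner_faceOfG` / `lefChar_eq_sum_faces`, is proved in CM/LefschetzChar).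

and PROVES `qw8Sufficiency_of_steps : Qw8Conj → Qw8ExtProd → Qw8DualPushPull → Qw8Milne →
Qw8FaceBridge → Qw8Sufficiency` (the subgroup argument of [QW8] Remark 2.6(c), mirroring
`HodgeCM.Prior.Qw8Sufficiency.LefschetzCalculus.sufficiency_int`) and the four-hypothesis corollary
`qw8Sufficiency_of_steps'` with step (i) discharged.

On the way: for a CM field every Galois translate commutes with complex conjugation
(`GalT.apply_conjugate`), hence `pullType Θ σ̄ = \overline{pullType Θ σ}` (`pullType_conjugate`), and the
Lefschetz character of the conjugate weight is the negative of the character (`lefChar_conjWeight`).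
-/

noncomputable section

open scoped TensorProduct
open NumberField NumberField.ComplexEmbedding

namespace HodgeCM

open Literature.AlgebraicGeometry.Motives (CMType)
open Literature.AlgebraicGeometry.Motives.HodgeStructure (conj conj_tmul conj_smul conj_conj
  conj_baseChange ofRat ofRat_apply)
open CMTypeOps

/-! ### Complex conjugation and Galois translates on a CM field -/

section ConjCM

variable {F : Type} [Field F] [NumberField F] [IsCMField F]

variable (F) in
/-- Complex conjugation of the CM field `F` (Mathlib's `IsCMField.complexConj`) as a `ℚ`-algebra
automorphism. -/
def conjAlgEquiv : F ≃ₐ[ℚ] F :=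
  AlgEquiv.ofRingEquiv (f := (IsCMField.complexConj F).toRingEquiv) (fun r => by simp)

/-- `conjAlgEquiv F` acts as Mathlib's `IsCMField.complexConj F` (definitional unfolding lemma). -/
@[simp] theorem conjAlgEquiv_apply (x : F) : conjAlgEquiv F x = IsCMField.complexConj F x := rfl

/-- `σ̄ = σ ∘ c_F`: every complex embedding intertwines the CM conjugation with complex conjugation. -/
theorem conjugate_eq_comp_conjAlgEquiv (σ : F →+* ℂ) :
    conjugate σ = σ.comp (conjAlgEquiv F : F →+* F) := by
  ext x
  rw [conjugate_coe_eq, RingHom.comp_apply]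
  exact (IsCMField.complexEmbedding_complexConj F σ x).symm

/-- For a CM field every Galois translate commutes with complex conjugation (`c_F` is an automorphism of
`F`, and Galois translates commute with `Aut(F)`). -/
theorem GalT.apply_conjugate (P : GalT F) (σ : F →+* ℂ) : P.1 (conjugate σ) = conjugate (P.1 σ) := by
  rw [conjugate_eq_comp_conjAlgEquiv σ, GalT.apply_comp, ← conjugate_eq_comp_conjAlgEquiv]

attribute [local instance] Classical.propDecidable in
/-- `Θ^{(σ̄)} = \overline{Θ^{(σ)}}`. -/
theorem pullType_conjugate (Θ : CMType F) (σ : F →+* ℂ) :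
    pullType Θ (conjugate σ) = barCM (pullType Θ σ) := by
  apply Subtype.ext
  ext P
  rw [mem_pullType, mem_barCM, mem_pullType, GalT.apply_conjugate, conjugate_mem_iff_notMem]

/-- The embedding `σ ↦ σ̄` of `Hom(F, ℂ)` into itself. -/
def conjEmb (F : Type) [Field F] : (F →+* ℂ) ↪ (F →+* ℂ) :=
  ⟨conjugate, (involutive_conjugate F).injective⟩

omit [NumberField F] [IsCMField F] in
/-- `conjEmb F σ = σ̄` (definitional unfolding lemma for the embedding `σ ↦ σ̄`). -/
@[simp] theorem conjEmb_apply (σ : F →+* ℂ) : conjEmb F σ = conjugate σ := rfl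

/-- The conjugate weight `S̄ = (σ̄)_{σ ∈ S}` (factor-wise). -/
def conjWeight {n : ℕ} (S : Fin (n + 1) → Finset (F →+* ℂ)) : Fin (n + 1) → Finset (F →+* ℂ) :=
  fun j => (S j).map (conjEmb F)

/-- **[QW8] Thm 2.5 step (i), character half:** `a(e_{S̄}) = −a(e_S)`. -/
theorem lefChar_conjWeight {n : ℕ} (Θ : Fin (n + 1) → CMType F) (S : Fin (n + 1) → Finset (F →+* ℂ)) :
    lefChar Θ (conjWeight S) = -lefChar Θ S := by
  unfold lefChar conjWeight
  simp only [Finset.sum_map, conjEmb_apply, pullType_conjugate, achar_bar, Finset.sum_neg_distrib]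

end ConjCM

/-! ### Complex conjugation of coefficients preserves complexified rational subspaces -/

/-- `conj ⊗ id` preserves `W ⊗ ℂ` for every rational subspace `W`. -/
theorem conj_mem_baseChange {V : Type*} [AddCommGroup V] [Module ℚ V] (W : Submodule ℚ V)
    {x : ℂ ⊗[ℚ] V} (hx : x ∈ W.baseChange ℂ) : conj x ∈ W.baseChange ℂ := by
  rw [Submodule.baseChange_eq_span] at hx ⊢
  induction hx using Submodule.span_induction with
  | mem y hy =>
    obtain ⟨m, hm, rfl⟩ := hy
    exact Submodule.subset_span ⟨m, hm, by simp⟩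
  | zero => simp
  | add y z _ _ hy hz => rw [map_add]; exact add_mem hy hz
  | smul c y _ hy => rw [conj_smul]; exact Submodule.smul_mem _ _ hy

namespace Universe

variable (U : Universe)

/-! ### The pool: nonzero complex weight vectors on the products `∏_j A_{(F,Θ_j)}` -/

/-- A **nonzero weight vector datum**: a product `A′ = ∏_{j ≤ n} A_{(F,Θ_j)}` of CM abelian varieties of
the CM field `F`, an even degree `2p`, a weight `S = (S_j)_j` and a NONZERO class `x ∈ H^{2p}(A′, ℂ)` of
weight `S` (`IsWeightVector`).  [QW8] §2.2 "`T`-weight vectors" (tex ll. 177–185), in the cohomological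
form of `IsWeightVector`; in the intended model `x = c · e_S`, `c ∈ ℂ^×`, since weight spaces are lines.
The pool of [QW8] Thm 2.5 / Def 2.7.  `x ≠ 0` is essential: `0` has every weight and is algebraic. -/
structure WVec (F : CMField) where
  /-- number of factors minus one -/
  n : ℕ
  /-- the CM types of the factors -/
  Θ : Fin (n + 1) → CMType F
  /-- half the degree -/
  p : ℕ
  /-- the weight, factor-wise -/
  S : Fin (n + 1) → Finset ((F : Type) →+* ℂ)
  /-- the class -/
  x : U.CohC (U.cmProd F Θ) (2 * p)
  ne_zero : x ≠ 0
  isWeightVector : U.IsWeightVector F Θ S (2 * p) x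

namespace WVec

variable {U} {F : CMField}

/-- the Lefschetz character `a(w)` of the weight ([QW8] Def 2.3; `lefChar`) -/
def achar (w : U.WVec F) : Asym F := lefChar w.Θ w.S

/-- "`w` is algebraic (with complex coefficients)": `x ∈ Alg^p(A′) ⊗ ℂ`. -/
def IsAlg (w : U.WVec F) : Prop := w.x ∈ U.algC (U.cmProd F w.Θ) w.p

/-- The Lefschetz character of a weight vector built with the anonymous constructor is `lefChar Θ S`
(definitional unfolding lemma). -/
@[simp] theorem achar_mk (n : ℕ) (Θ : Fin (n + 1) → CMType F) (p : ℕ) (S : Fin (n + 1) → Finset ((F : Type) →+* ℂ))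
    (x : U.CohC (U.cmProd F Θ) (2 * p)) (h0 : x ≠ 0) (hw : U.IsWeightVector F Θ S (2 * p) x) :
    (WVec.mk n Θ p S x h0 hw : U.WVec F).achar = lefChar Θ S := rfl

/-- **Step (i) construction:** complex conjugation of coefficients `x ↦ (conj ⊗ id) x` turns a weight
vector of weight `S` into one of weight `S̄` (the CM actions are defined over `ℚ`, `conj` is antilinear). -/
def conj (w : U.WVec F) : U.WVec F where
  n := w.n
  Θ := w.Θ
  p := w.p
  S := conjWeight w.S
  x := Literature.AlgebraicGeometry.Motives.HodgeStructure.conj w.x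
  ne_zero h := w.ne_zero (by
    rw [← conj_conj w.x, h, map_zero])
  isWeightVector j a M hM := by
    have hx := w.isWeightVector j a M hM
    show (U.pull M (2 * w.p)).baseChange ℂ (Literature.AlgebraicGeometry.Motives.HodgeStructure.conj w.x) = _
    rw [← conj_baseChange, show (U.pull M (2 * w.p)).baseChange ℂ w.x = U.pullC M (2 * w.p) w.x from rfl, hx,
      conj_smul, map_prod]
    congr 1
    unfold conjWeight
    rw [Finset.prod_map]
    refine Finset.prod_congr rfl (fun s _ => ?_)
    rw [conjEmb_apply, conjugate_coe_eq]

/-- The Lefschetz character of the coefficient-conjugate weight vector is the negative of the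
original one: `a(w̄) = -a(w)` ([QW8] Thm 2.5 step (i), via `lefChar_conjWeight`). -/
@[simp] theorem achar_conj (w : U.WVec F) : w.conj.achar = -w.achar := lefChar_conjWeight w.Θ w.S

/-- Coefficient-wise complex conjugation preserves algebraicity: if `x ∈ Alg^p ⊗ ℂ` then so is
`(conj ⊗ id) x` (the algebraic classes are defined over `ℚ`). -/
theorem IsAlg.conj {w : U.WVec F} (hw : w.IsAlg) : w.conj.IsAlg := conj_mem_baseChange _ hw

end WVec

/-! ### The five obligations of [QW8] Thm 2.5, as named `Prop`s -/

/-- **[QW8] Thm 2.5 step (i)** (tex l. 251–254: "if `ε_α = −1` replace `w_α` by `γ w_α`, `γ ∈ Aut(ℚ̄/ℚ)`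
inducing `ι` on `F`: again an algebraic weight vector, and `a(γ w_α) = −a(w_α)`").  Universe form, with
complex instead of `ℚ̄` coefficients: for every nonzero algebraic weight vector there is one with the
opposite Lefschetz character.  DISCHARGED below (`qw8Conj_holds`): take `γ = conj ⊗ id` on
`H^{2p}(A′, ℚ) ⊗ ℂ`; no model axiom is needed.  Source: [QW8] v1 892bb948 Thm 2.5 (i); Deligne, Hodge II,
2.1.4 (the real structure). -/
def Qw8Conj : Prop :=
  ∀ (F : CMField) (v : U.WVec F), v.IsAlg → ∃ v' : U.WVec F, v'.IsAlg ∧ v'.achar = -v.achar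

/-- **[QW8] Thm 2.5 step (ii)** (tex l. 254–255: "`W := w₁ ⊠ ⋯ ⊠ w_n` on `Y′` is an algebraic weight
vector with `a(W) = Σ_α ε_α a(w_α) = a(e)`").  Universe form: the characters carried by nonzero
algebraic weight vectors are closed under addition — given algebraic `v` on `∏_j A_{Θ_j}` and `w` on
`∏_j A_{Θ′_j}` there is an algebraic `z` (in the model `z = pr₁^* v ∪ pr₂^* w` on the concatenated product,
re-bracketed to a `cmProd`) with `a(z) = a(v) + a(w)`.  OPEN INPUT (model infrastructure, not print-hard):
needs Künneth in all degrees for `U.prod` (`v ⊠ w ≠ 0`), functoriality of `alg` under pull-back and cup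
(M8 `Fact_pull_alg`, M9 `Fact_cup_alg`), compatibility of the factor actions with re-bracketing
(M1, M2), and the additivity `lefChar (append Θ Θ′) (append S S′) = lefChar Θ S + lefChar Θ′ S′` (pure
combinatorics).  Why it might fail: only by a mismatch between `IsFactorAct` on the re-bracketed
`prodFin` and on `Y × Y′` (the universe has pairing morphisms only through `Fact_lift`).  Sources: [QW8]
Thm 2.5 (ii); Voisin, Hodge Theory I, Thm 11.38 (Künneth); Fulton, Intersection Theory, §19.1. -/
def Qw8ExtProd : Prop :=
  ∀ (F : CMField), IsGalois ℚ F → 6 ≤ Module.finrank ℚ F → ∀ (v w : U.WVec F), v.IsAlg → w.IsAlg →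
    ∃ z : U.WVec F, z.IsAlg ∧ z.achar = v.achar + w.achar

/-- **[QW8] Thm 2.5 steps (iii) + (v)** (tex ll. 255–258 and 260–261: the Poincaré-dual partner
`W^∨ = c⁻¹ e_{J′}` with `a(W^∨) = −a(W)`, `⟨W, W^∨⟩ = 1`, `Z := e ⊠ W^∨`, and
`e = pr_{Y*}(Z · pr_{Y′}^* W)`: "pull-backs, cup products and push-forwards of algebraic classes are
algebraic").  Universe form: for every nonzero weight vector `e` and nonzero ALGEBRAIC weight vector `W`
there is a nonzero weight vector `Z` (in the model `e ⊠ W^∨`, `W^∨ = ±c⁻¹ e_{Sᶜ}` the complementary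
monomial, on the concatenated product) with `a(Z) = a(e) − a(W)` and such that `Z` algebraic ⇒ `e`
algebraic.  The character identity is `lefChar`-additivity plus `a(e_S) + a(e_{Sᶜ}) = a(e_univ) = 0`
(`Hom(F,ℂ)` is a union of conjugate pairs; cf. `lefChar_conjWeight`).  OPEN INPUT (model infrastructure):
needs `H^•(A′) = ⋀^• H¹` (so that `e_{Sᶜ} ≠ 0` pairs to `1` with `e_S`), Poincaré duality and Gysin
push-forward `pr_*` preserving algebraic classes, and the projection formula — none of which the
`Universe` signature carries (it has `tr` and `cup` but no push-forward).  Why it might fail: as stated it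
quantifies over ALL nonzero weight vectors `e` of the pool (any weight, any even degree), which is what the
model gives; a failure could only come from the re-bracketing of products as in `Qw8ExtProd`.  Sources:
[QW8] Thm 2.5 (iii),(v); Voisin I §11.3, II §9 (Gysin, projection formula); Kleiman, Dix exposés (1968) §1. -/
def Qw8DualPushPull : Prop :=
  ∀ (F : CMField), IsGalois ℚ F → 6 ≤ Module.finrank ℚ F → ∀ (e W : U.WVec F), W.IsAlg →
    ∃ Z : U.WVec F, Z.achar = e.achar - W.achar ∧ (Z.IsAlg → e.IsAlg)

/-- **[QW8] Thm 2.5 step (iv)** (tex ll. 258–260: "`a(Z) = a(e) + a(W^∨) = 0`. By Lemma 2.4(b), `Z` is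
invariant under `L(A)`; by (3) [Milne] it is a `ℚ̄`-combination of products of divisor classes, hence
algebraic") — **the one PRINT input of the theorem**.  Universe form: a nonzero weight vector on
`∏_j A_{(F,Θ_j)}` (F Galois CM, `[F:ℚ] ≥ 6`) whose Lefschetz character vanishes in `Asym F` is a
complexified algebraic class.  OPEN INPUT.  Published inputs that close it: Milne, *Lefschetz classes on
abelian varieties*, Duke Math. J. 96 (1999) 639–675, Thm 3.2, Def 4.3, Thm 4.4, Cor 4.5, Cor 4.7
(`H^{2s}(A^r, ℚ̄)^{L(A)}` = Lefschetz classes = algebraic, `L(A) = S(A)` for CM `A`;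
`[corpus:paper:doi-10-1215-s0012-7094-99-09620-5 pp. 2, 15, 21]`), the Lefschetz (1,1) theorem (M10), and
[QW8] Lemma 2.4(a),(b) (internal, elementary: the weights of `S_Y` and "`a(e_I) = 0 ⇔ e_I` is
`L(A)`-invariant").  Why it might fail: the dictionary `Asym F → X^*(S_Y)/⟨twists⟩`,
`[Θ_j^{(s)}] ↦ [s|_{L_O}]` (SKELETON §5 item 6) must be INJECTIVE on the span of the characters that occur,
so that `lefChar Θ S = 0` really is `L(A′)`-invariance of `e_S`; for non-primitive `Θ_j` the factor is a
power of a simple CM variety of a smaller field and the bookkeeping of [QW8] L2.4(a) is by orbits `O`. -/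
def Qw8Milne : Prop :=
  ∀ (F : CMField), IsGalois ℚ F → 6 ≤ Module.finrank ℚ F → ∀ (z : U.WVec F), z.achar = 0 → z.IsAlg

/-- **The ā-bridge** ([QW8] Lemma 2.9 "Weil data" + Remark 2.6(a) "weight components of algebraic classes are algebraic";
Prop. 3.4(a) is the `(ℤ/2)³` instance; tex ll. 292–300, 263–266, 393–402): if the face line `W_F(P(f)) ⊆ H⁴(P(f), ℚ)`
is algebraic then for every `σ₀ ∈ Hom(F, ℂ)` the `σ₀`-Weil generator `e_{J_{σ₀}} = ⋃_i pr_i^* y_i` (`0 ≠ y_i ∈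
H¹(A_{Φ_i})_{σ₀}`) is a NONZERO, ALGEBRAIC weight vector of weight `(i ↦ {σ₀})` on `P(f) = ∏_i A_{(F, f.corner i)}` —
so that its Lefschetz character is `lefChar f.corner (fun _ ↦ {σ₀})` by definition (the combinatorial dictionary
`lefChar_corner_faceOfG`, `lefChar_eq_sum_faces` is PROVED in CM/LefschetzChar).  PROVED from the model axioms
(`HodgeCM.Universe.qw8FaceBridge_holds`, file `StubTree/Qw8FaceBridge.lean`, run 16), in two named halves: (a)
`Qw8WeilGenWeight` — the generator is a weight vector of weight `{σ₀}` on each factor (M1 `Fact_pull_id`, M2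
`Fact_pull_comp`, M3 `Fact_pull_cup`, the definition of `eigenLine`; `prj 3` versus `pr4` after `pull`); (b)
`Qw8WeilGenAlg` — it is nonzero and lies in `Alg ⊗ ℂ`: linear algebra over M12 `Fact_eigenLine` and M15
`Fact_weilLine_rank` (all `σ`-generators are proportional; `span_ℂ(gens) ⊇ W_F(P) ⊗ ℂ` has complex dimension `[F:ℚ] =
#Hom(F,ℂ)` by flatness of `ℂ/ℚ`; hence no `σ`-generator on nonzero eigenvectors vanishes and `span_ℂ(gens) = W_F(P) ⊗ ℂ
⊆ Alg² ⊗ ℂ` — the model form of `W_F(P) ⊗ ℂ = ⊕_σ ℂ e_{J_σ}`, Deligne LNM 900 (4.4), Moonen–Zarhin Duke 77 (1995) §2,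
[QW8] L2.9; M15, stated for the DEFINED `U.weilLine = ofRat⁻¹(span_ℂ gens)`, carries exactly the Künneth non-degeneracy
and the descent to `ℚ`).  Kept as a named `Prop` so that `qw8Sufficiency_of_steps` stays free of `ModelAxioms`. -/
def Qw8FaceBridge : Prop :=
  ∀ (F : CMField), IsGalois ℚ F → 6 ≤ Module.finrank ℚ F → ∀ (f : Face F), U.WeilFaceAlgebraic F f →
    ∀ (σ₀ : (F : Type) →+* ℂ), ∃ x : U.CohC (U.cmProd F f.corner) (2 * 2), x ≠ 0 ∧
      U.IsWeightVector F f.corner (fun _ => {σ₀}) (2 * 2) x ∧ x ∈ U.algC (U.cmProd F f.corner) 2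

/-! ### Step (i) discharged -/

/-- **[QW8] Thm 2.5 (i) holds in every universe**: conjugate the coefficients. -/
theorem qw8Conj_holds : U.Qw8Conj := fun _F v hv => ⟨v.conj, hv.conj, v.achar_conj⟩

/-! ### The assembly: (i)–(v) + bridge ⇒ `Qw8Sufficiency` -/

/-- **`Qw8Sufficiency` from its five obligations** — the argument of [QW8] Thm 2.5 / Remark 2.6(c):
the characters of nonzero algebraic weight vectors form (once one exists) an additive subgroup of
`Asym F` (steps (i), (ii)); it contains the face characters `lefChar (f_i).corner (fun _ ↦ {σ₀})` (the
bridge), hence `a(e) = Σ_i c_i · a(w_i)`; pick such a `W`, pass to `Z` with `a(Z) = a(e) − a(W) = 0`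
(steps (iii),(v)), which is algebraic by Milne (iv), hence so is `e`.  The case `x = 0` is trivial and the
case of an empty combination is Milne directly. -/
theorem qw8Sufficiency_of_steps (hC : U.Qw8Conj) (hE : U.Qw8ExtProd) (hD : U.Qw8DualPushPull)
    (hM : U.Qw8Milne) (hB : U.Qw8FaceBridge) : U.Qw8Sufficiency := by
  intro F hGal h6 hWeil n Θ p S x _hS hx hchar
  by_cases hx0 : x = 0
  · rw [hx0]; exact Submodule.zero_mem _
  obtain ⟨σ₀, m, f, c, hsum⟩ := hchar
  let e : U.WVec F := ⟨n, Θ, p, S, x, hx0, hx⟩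
  change e.IsAlg
  have he : e.achar = lefChar Θ S := rfl
  by_cases ha : e.achar = 0
  · exact hM F hGal h6 e ha
  -- the set of characters carried by nonzero algebraic weight vectors
  let A : Set (Asym F) := {a | ∃ z : U.WVec F, z.IsAlg ∧ z.achar = a}
  have hAneg : ∀ a ∈ A, -a ∈ A := by
    rintro a ⟨z, hz, rfl⟩
    obtain ⟨z', hz', h'⟩ := hC F z hz
    exact ⟨z', hz', h'⟩
  have hAadd : ∀ a ∈ A, ∀ b ∈ A, a + b ∈ A := by
    rintro a ⟨z, hz, rfl⟩ b ⟨w, hw, rfl⟩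
    obtain ⟨y, hy, h'⟩ := hE F hGal h6 z w hz hw
    exact ⟨y, hy, h'⟩
  have hface : ∀ i, lefChar (f i).corner (fun _ => ({σ₀} : Finset ((F : Type) →+* ℂ))) ∈ A := by
    intro i
    obtain ⟨y, hy0, hyw, hya⟩ := hB F hGal h6 (f i) (hWeil (f i)) σ₀
    exact ⟨⟨3, (f i).corner, 2, fun _ => {σ₀}, y, hy0, hyw⟩, hya, rfl⟩
  -- the combination is nonempty since `a(e) ≠ 0`
  have hm : 0 < m := by
    rcases Nat.eq_zero_or_pos m with rfl | hm
    · exact absurd (by rw [he, hsum]; simp) ha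
    · exact hm
  have h0 : (0 : Asym F) ∈ A := by
    have h := hAadd _ (hface ⟨0, hm⟩) _ (hAneg _ (hface ⟨0, hm⟩))
    rwa [add_neg_cancel] at h
  let G : AddSubgroup (Asym F) :=
    { carrier := A
      zero_mem' := h0
      add_mem' := fun ha hb => hAadd _ ha _ hb
      neg_mem' := fun ha => hAneg _ ha }
  have heA : e.achar ∈ G := by
    rw [he, hsum]
    exact G.sum_mem (fun i _ => G.zsmul_mem (hface i) (c i))
  obtain ⟨W, hW, hWa⟩ := heA
  obtain ⟨Z, hZa, hZ⟩ := hD F hGal h6 e W hW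
  exact hZ (hM F hGal h6 Z (by rw [hZa, hWa, sub_self]))

/-- The same with step (i) discharged: **`Qw8Sufficiency` follows from the four open inputs**
`Qw8ExtProd` (Künneth/exterior product), `Qw8DualPushPull` (Poincaré dual + push–pull), `Qw8Milne`
(Milne 1999) and `Qw8FaceBridge` (Weil generators are nonzero algebraic weight vectors). -/
theorem qw8Sufficiency_of_steps' (hE : U.Qw8ExtProd) (hD : U.Qw8DualPushPull) (hM : U.Qw8Milne)
    (hB : U.Qw8FaceBridge) : U.Qw8Sufficiency :=
  U.qw8Sufficiency_of_steps U.qw8Conj_holds hE hD hM hB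

end Universe

end HodgeCM

end
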